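import Mathlib
import Summits.NavierStokesRegularity.NavierStokesRegularity.Theses.FilamentSkeletonRss

/-!
# Route FilamentSkeletonRss · crux `CoreGluing` (stmt-NavierStokesRegularity-15401) — line `Sketch`, tool stub `stub_ellipticDatumStrainModel`

Helper file (theorems only) supporting the crux item; lands with `--supports stmt-NavierStokesRegularity-15401`.

**Link (cross strain) for the elliptic `C₄` datum `D*`.** In the rotating Leray frame the rescaled
skeleton field of the datum is
`F y = ½ y − e₃ × y + Σ_{k=1,2,3} (‖y − P_k‖² − ⟪y − P_k, e_k⟫²)⁻¹ · e_k × (y − P_k)`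
(drift plus straight-line Biot–Savart induction of the three image lines `P_k + ℝ e_k`). Along the
core line `x = P₀ + t e₀` and in a cross direction `v = a u₁ + b u₂` (`u₁ = (13, −18, −12)`,
`u₂ = (0, 14, −21)`, an orthogonal basis of `e₀^⊥` with `‖u₁‖² = ‖u₂‖² = 637`) the directional strain
`d/ds ⟪F(x + s v), v⟫|_{s=0}` is the closed-form quadratic form `a² S₁₁(t) + 2ab S₁₂(t) + b² S₂₂(t)`.

Proof (1-D, no `fderiv`): `g(s) = ⟪F(x + s v), v⟫ = ½⟪x, v⟫ + ½ s ‖v‖² − ⟪e₃ × x, v⟫ + Σ_k c_k / D_k(s)`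
because `⟪e₃ × v, v⟫ = 0` and `c_k = ⟪e_k × (x + s v − P_k), v⟫ = ⟪e_k × (x − P_k), v⟫` is constant in
`s`, while `D_k(s) = D_k + 2 β_k s + γ_k s²` is a quadratic (`strain_denom_quadratic`). Hence
`g′(0) = ½‖v‖² − Σ_k 2 β_k c_k / D_k²` (`strain_hasDerivAt_link`, abstract in the data); reading off
`D_k, β_k, c_k, ‖v‖²` in coordinates (`strain_datum_*`) and clearing the three positive denominators
`D₁ = (9540t² − 56532t + 84329)/9604`, `D₂ = (720t² − 3696t + 6664)/2401`,
`D₃ = (9540t² − 41412t + 45521)/9604` gives the stated closed form by `ring`.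
-/

set_option linter.dupNamespace false

noncomputable section

namespace Summit.NavierStokesRegularity.NavierStokesRegularity.Theorems

open Literature.Analysis.FluidPDE
open scoped RealInnerProductSpace

/-- Coordinates of the inner product on `ℝ³`. [folklore] -/
private theorem strain_inner_three (a b : EuclideanSpace ℝ (Fin 3)) :
    inner ℝ a b = a 0 * b 0 + a 1 * b 1 + a 2 * b 2 := by
  simp [PiLp.inner_apply, Fin.sum_univ_three, mul_comm]

/-- `‖a‖² = Σ aᵢ²` on `ℝ³`. [folklore] -/
private theorem strain_norm_sq_three (a : EuclideanSpace ℝ (Fin 3)) :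
    ‖a‖ ^ 2 = a 0 ^ 2 + a 1 ^ 2 + a 2 ^ 2 := by
  rw [EuclideanSpace.real_norm_sq_eq, Fin.sum_univ_three]

/-- Coordinates of the triple product `⟨a × b, c⟩` on `ℝ³`. [folklore] -/
private theorem strain_inner_cross_three (a b c : EuclideanSpace ℝ (Fin 3)) :
    inner ℝ (cross a b) c = (a 1 * b 2 - a 2 * b 1) * c 0 + (a 2 * b 0 - a 0 * b 2) * c 1
      + (a 0 * b 1 - a 1 * b 0) * c 2 := by
  rw [strain_inner_three]
  simp [cross, cross_apply]

/-- `⟨x + s v, v⟩ = ⟨x, v⟩ + s ‖v‖²`. [folklore] -/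
private theorem strain_inner_shift (x v : EuclideanSpace ℝ (Fin 3)) (s : ℝ) :
    inner ℝ (x + s • v) v = inner ℝ x v + s * ‖v‖ ^ 2 := by
  rw [inner_add_left, real_inner_smul_left, real_inner_self_eq_norm_sq]

/-- `⟨n × (x + s v), v⟩ = ⟨n × x, v⟩` (the rotation does not strain along `v`). [folklore] -/
private theorem strain_cross_shift (n x v : EuclideanSpace ℝ (Fin 3)) (s : ℝ) :
    inner ℝ (cross n (x + s • v)) v = inner ℝ (cross n x) v := by
  rw [strain_inner_cross_three, strain_inner_cross_three]
  simp only [PiLp.add_apply, PiLp.smul_apply, smul_eq_mul]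
  ring

/-- `⟨e × (x + s v − P), v⟩ = ⟨e × (x − P), v⟩`: the Biot–Savart numerator is constant along the
probing line. [folklore] -/
private theorem strain_cross_term_const (e x v P : EuclideanSpace ℝ (Fin 3)) (s : ℝ) :
    inner ℝ (cross e (x + s • v - P)) v = inner ℝ (cross e (x - P)) v := by
  rw [strain_inner_cross_three, strain_inner_cross_three]
  simp only [PiLp.add_apply, PiLp.sub_apply, PiLp.smul_apply, smul_eq_mul]
  ring

/-- The squared distance to a line, `‖y − P‖² − ⟨y − P, e⟩²`, restricted to the probing line
`y = x + s v`, is the quadratic `D + 2βs + γs²`. [folklore] -/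
private theorem strain_denom_quadratic (x v P e : EuclideanSpace ℝ (Fin 3)) (s : ℝ) :
    ‖x + s • v - P‖ ^ 2 - (inner ℝ (x + s • v - P) e) ^ 2 =
      (‖x - P‖ ^ 2 - (inner ℝ (x - P) e) ^ 2)
        + 2 * (inner ℝ (x - P) v - inner ℝ (x - P) e * inner ℝ v e) * s
        + (‖v‖ ^ 2 - (inner ℝ v e) ^ 2) * s ^ 2 := by
  simp only [strain_norm_sq_three, strain_inner_three, PiLp.add_apply, PiLp.sub_apply,
    PiLp.smul_apply, smul_eq_mul]
  ring

/-- Linearity of `⟨·, v⟩` on the five summands of the model field. [folklore] -/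
private theorem strain_inner_model_expand (y w₀ w₁ w₂ w₃ v : EuclideanSpace ℝ (Fin 3))
    (h α r₁ r₂ r₃ : ℝ) :
    inner ℝ (h • y - α • w₀ + r₁ • w₁ + r₂ • w₂ + r₃ • w₃) v
      = h * inner ℝ y v - α * inner ℝ w₀ v + r₁ * inner ℝ w₁ v + r₂ * inner ℝ w₂ v
        + r₃ * inner ℝ w₃ v := by
  simp only [inner_add_left, inner_sub_left, real_inner_smul_left]

/-- One Lorentzian along the probing line: `d/ds [c / (D + 2βs + γs²)]|₀ = −2βc/D²`. [folklore] -/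
private theorem strain_hasDerivAt_lorentz (D β γ c : ℝ) (hD : D ≠ 0) :
    HasDerivAt (fun s : ℝ => 1 / (D + 2 * β * s + γ * s ^ 2) * c) (-(c * (2 * β) / D ^ 2)) 0 := by
  have hq : HasDerivAt (fun s : ℝ => D + 2 * β * s + γ * s ^ 2) (2 * β) 0 := by
    have h1 : HasDerivAt (fun s : ℝ => 2 * β * s) (2 * β) 0 := by
      simpa using (hasDerivAt_id (0 : ℝ)).const_mul (2 * β)
    have h2 : HasDerivAt (fun s : ℝ => γ * s ^ 2) 0 0 := by
      simpa using (hasDerivAt_pow 2 (0 : ℝ)).const_mul γ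
    simpa using (h1.const_add D).fun_add h2
  have h := ((hasDerivAt_const (0 : ℝ) (1 : ℝ)).div hq (by simpa using hD)).mul_const c
  refine h.congr_deriv ?_
  simp only [mul_zero, add_zero, zero_mul, ne_eq, OfNat.ofNat_ne_zero, not_false_eq_true,
    zero_pow]
  ring

/-- The scalar model `½(K + sL) − M + Σ_k c_k/(D_k + 2β_k s + γ_k s²)` along the probing line has
derivative `½ L − Σ_k 2β_k c_k / D_k²` at `s = 0`. [folklore] -/
private theorem strain_hasDerivAt_scalar (K L M D₁ β₁ γ₁ c₁ D₂ β₂ γ₂ c₂ D₃ β₃ γ₃ c₃ : ℝ)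
    (h₁ : D₁ ≠ 0) (h₂ : D₂ ≠ 0) (h₃ : D₃ ≠ 0) :
    HasDerivAt (fun s : ℝ => (1 / 2 : ℝ) * (K + s * L) - M
        + 1 / (D₁ + 2 * β₁ * s + γ₁ * s ^ 2) * c₁
        + 1 / (D₂ + 2 * β₂ * s + γ₂ * s ^ 2) * c₂
        + 1 / (D₃ + 2 * β₃ * s + γ₃ * s ^ 2) * c₃)
      ((1 / 2 : ℝ) * L - c₁ * (2 * β₁) / D₁ ^ 2 - c₂ * (2 * β₂) / D₂ ^ 2
        - c₃ * (2 * β₃) / D₃ ^ 2) 0 := by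
  have h0 : HasDerivAt (fun s : ℝ => (1 / 2 : ℝ) * (K + s * L) - M) ((1 / 2 : ℝ) * L) 0 := by
    have h := ((((hasDerivAt_id (0 : ℝ)).mul_const L).const_add K).const_mul (1 / 2 : ℝ)).sub_const M
    simpa using h
  exact (((h0.fun_add (strain_hasDerivAt_lorentz D₁ β₁ γ₁ c₁ h₁)).fun_add
    (strain_hasDerivAt_lorentz D₂ β₂ γ₂ c₂ h₂)).fun_add
    (strain_hasDerivAt_lorentz D₃ β₃ γ₃ c₃ h₃)).congr_deriv (by ring)

/-- **Abstract 1-D link.** For the model field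
`F y = ½ y − α n × y + Σ_k (‖y − P_k‖² − ⟪y − P_k, e_k⟫²)⁻¹ · e_k × (y − P_k)` and any point `x` off the
three lines, `s ↦ ⟪F(x + s v), v⟫` has derivative `½‖v‖² − Σ_k c_k · 2β_k / D_k²` at `s = 0`, where
`D_k = ‖x − P_k‖² − ⟪x − P_k, e_k⟫²`, `β_k = ⟪x − P_k, v⟫ − ⟪x − P_k, e_k⟫⟪v, e_k⟫`,
`c_k = ⟪e_k × (x − P_k), v⟫`. [folklore] -/
private theorem strain_hasDerivAt_link (x v n P₁ e₁ P₂ e₂ P₃ e₃ : EuclideanSpace ℝ (Fin 3)) (α : ℝ)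
    (h₁ : ‖x - P₁‖ ^ 2 - (inner ℝ (x - P₁) e₁) ^ 2 ≠ 0)
    (h₂ : ‖x - P₂‖ ^ 2 - (inner ℝ (x - P₂) e₂) ^ 2 ≠ 0)
    (h₃ : ‖x - P₃‖ ^ 2 - (inner ℝ (x - P₃) e₃) ^ 2 ≠ 0) :
    HasDerivAt (fun s : ℝ => inner ℝ ((1 / 2 : ℝ) • (x + s • v) - α • cross n (x + s • v)
        + ((1 : ℝ) / (‖(x + s • v) - P₁‖ ^ 2 - (inner ℝ ((x + s • v) - P₁) e₁) ^ 2)) •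
            cross e₁ ((x + s • v) - P₁)
        + ((1 : ℝ) / (‖(x + s • v) - P₂‖ ^ 2 - (inner ℝ ((x + s • v) - P₂) e₂) ^ 2)) •
            cross e₂ ((x + s • v) - P₂)
        + ((1 : ℝ) / (‖(x + s • v) - P₃‖ ^ 2 - (inner ℝ ((x + s • v) - P₃) e₃) ^ 2)) •
            cross e₃ ((x + s • v) - P₃)) v)
      ((1 / 2 : ℝ) * ‖v‖ ^ 2
        - inner ℝ (cross e₁ (x - P₁)) v
            * (2 * (inner ℝ (x - P₁) v - inner ℝ (x - P₁) e₁ * inner ℝ v e₁))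
            / (‖x - P₁‖ ^ 2 - (inner ℝ (x - P₁) e₁) ^ 2) ^ 2
        - inner ℝ (cross e₂ (x - P₂)) v
            * (2 * (inner ℝ (x - P₂) v - inner ℝ (x - P₂) e₂ * inner ℝ v e₂))
            / (‖x - P₂‖ ^ 2 - (inner ℝ (x - P₂) e₂) ^ 2) ^ 2
        - inner ℝ (cross e₃ (x - P₃)) v
            * (2 * (inner ℝ (x - P₃) v - inner ℝ (x - P₃) e₃ * inner ℝ v e₃))
            / (‖x - P₃‖ ^ 2 - (inner ℝ (x - P₃) e₃) ^ 2) ^ 2) 0 := by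
  refine (strain_hasDerivAt_scalar (inner ℝ x v) (‖v‖ ^ 2) (α * inner ℝ (cross n x) v)
    (‖x - P₁‖ ^ 2 - (inner ℝ (x - P₁) e₁) ^ 2)
    (inner ℝ (x - P₁) v - inner ℝ (x - P₁) e₁ * inner ℝ v e₁) (‖v‖ ^ 2 - (inner ℝ v e₁) ^ 2)
    (inner ℝ (cross e₁ (x - P₁)) v)
    (‖x - P₂‖ ^ 2 - (inner ℝ (x - P₂) e₂) ^ 2)
    (inner ℝ (x - P₂) v - inner ℝ (x - P₂) e₂ * inner ℝ v e₂) (‖v‖ ^ 2 - (inner ℝ v e₂) ^ 2)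
    (inner ℝ (cross e₂ (x - P₂)) v)
    (‖x - P₃‖ ^ 2 - (inner ℝ (x - P₃) e₃) ^ 2)
    (inner ℝ (x - P₃) v - inner ℝ (x - P₃) e₃ * inner ℝ v e₃) (‖v‖ ^ 2 - (inner ℝ v e₃) ^ 2)
    (inner ℝ (cross e₃ (x - P₃)) v) h₁ h₂ h₃).congr_of_eventuallyEq
    (Filter.Eventually.of_forall fun s => ?_)
  beta_reduce
  rw [strain_inner_model_expand, strain_inner_shift, strain_cross_shift,
    strain_cross_term_const, strain_cross_term_const, strain_cross_term_const,
    strain_denom_quadratic, strain_denom_quadratic, strain_denom_quadratic]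

/-- Line `1` of the datum seen from the probing line: `D₁ = (9540t² − 56532t + 84329)/9604` and the
coordinates of `β₁`, `c₁` in `(a, b)`. [folklore] -/
private theorem strain_datum_one (t a b : ℝ) (x v : EuclideanSpace ℝ (Fin 3))
    (hx : x = !₂[((-2) : ℝ), (-(3 / 2 : ℝ)), ((-2) : ℝ)] + t • !₂[(6 / 7 : ℝ), (3 / 7 : ℝ), (2 / 7 : ℝ)])
    (hv : v = a • !₂[(13 : ℝ), ((-18) : ℝ), ((-12) : ℝ)] + b • !₂[(0 : ℝ), (14 : ℝ), ((-21) : ℝ)]) :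
    ‖x - !₂[(3 / 2 : ℝ), ((-2) : ℝ), ((-2) : ℝ)]‖ ^ 2
        - (inner ℝ (x - !₂[(3 / 2 : ℝ), ((-2) : ℝ), ((-2) : ℝ)])
            !₂[(-(3 / 7 : ℝ)), (6 / 7 : ℝ), (2 / 7 : ℝ)]) ^ 2
          = (9540 * t ^ 2 - 56532 * t + 84329) / 9604 ∧
      inner ℝ (x - !₂[(3 / 2 : ℝ), ((-2) : ℝ), ((-2) : ℝ)]) v
        - inner ℝ (x - !₂[(3 / 2 : ℝ), ((-2) : ℝ), ((-2) : ℝ)])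
            !₂[(-(3 / 7 : ℝ)), (6 / 7 : ℝ), (2 / 7 : ℝ)]
          * inner ℝ v !₂[(-(3 / 7 : ℝ)), (6 / 7 : ℝ), (2 / 7 : ℝ)]
          = a * (-362 / 49 + 684 / 343 * t) + b * (-32 / 7 - 24 / 49 * t) ∧
      inner ℝ (cross !₂[(-(3 / 7 : ℝ)), (6 / 7 : ℝ), (2 / 7 : ℝ)]
          (x - !₂[(3 / 2 : ℝ), ((-2) : ℝ), ((-2) : ℝ)])) v
          = a * (-121 / 7 + 6 * t) + b * (-145 / 2 + 171 / 7 * t) := by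
  subst hx hv
  rw [strain_inner_cross_three]
  simp only [strain_norm_sq_three, strain_inner_three]
  simp
  refine ⟨?_, ?_, ?_⟩ <;> ring

/-- Line `2` of the datum seen from the probing line: `D₂ = (720t² − 3696t + 6664)/2401` and the
coordinates of `β₂`, `c₂` in `(a, b)`. [folklore] -/
private theorem strain_datum_two (t a b : ℝ) (x v : EuclideanSpace ℝ (Fin 3))
    (hx : x = !₂[((-2) : ℝ), (-(3 / 2 : ℝ)), ((-2) : ℝ)] + t • !₂[(6 / 7 : ℝ), (3 / 7 : ℝ), (2 / 7 : ℝ)])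
    (hv : v = a • !₂[(13 : ℝ), ((-18) : ℝ), ((-12) : ℝ)] + b • !₂[(0 : ℝ), (14 : ℝ), ((-21) : ℝ)]) :
    ‖x - !₂[(2 : ℝ), (3 / 2 : ℝ), ((-2) : ℝ)]‖ ^ 2
        - (inner ℝ (x - !₂[(2 : ℝ), (3 / 2 : ℝ), ((-2) : ℝ)])
            !₂[(-(6 / 7 : ℝ)), (-(3 / 7 : ℝ)), (2 / 7 : ℝ)]) ^ 2
          = (720 * t ^ 2 - 3696 * t + 6664) / 2401 ∧
      inner ℝ (x - !₂[(2 : ℝ), (3 / 2 : ℝ), ((-2) : ℝ)]) v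
        - inner ℝ (x - !₂[(2 : ℝ), (3 / 2 : ℝ), ((-2) : ℝ)])
            !₂[(-(6 / 7 : ℝ)), (-(3 / 7 : ℝ)), (2 / 7 : ℝ)]
          * inner ℝ v !₂[(-(6 / 7 : ℝ)), (-(3 / 7 : ℝ)), (2 / 7 : ℝ)]
          = a * (1682 / 49 - 1968 / 343 * t) + b * (102 / 7 - 492 / 49 * t) ∧
      inner ℝ (cross !₂[(-(6 / 7 : ℝ)), (-(3 / 7 : ℝ)), (2 / 7 : ℝ)]
          (x - !₂[(2 : ℝ), (3 / 2 : ℝ), ((-2) : ℝ)])) v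
          = a * (150 / 7 - 12 * t) + b * (-34 + 48 / 7 * t) := by
  subst hx hv
  rw [strain_inner_cross_three]
  simp only [strain_norm_sq_three, strain_inner_three]
  simp
  refine ⟨?_, ?_, ?_⟩ <;> ring

/-- Line `3` of the datum seen from the probing line: `D₃ = (9540t² − 41412t + 45521)/9604` and the
coordinates of `β₃`, `c₃` in `(a, b)`. [folklore] -/
private theorem strain_datum_three (t a b : ℝ) (x v : EuclideanSpace ℝ (Fin 3))
    (hx : x = !₂[((-2) : ℝ), (-(3 / 2 : ℝ)), ((-2) : ℝ)] + t • !₂[(6 / 7 : ℝ), (3 / 7 : ℝ), (2 / 7 : ℝ)])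
    (hv : v = a • !₂[(13 : ℝ), ((-18) : ℝ), ((-12) : ℝ)] + b • !₂[(0 : ℝ), (14 : ℝ), ((-21) : ℝ)]) :
    ‖x - !₂[(-(3 / 2 : ℝ)), (2 : ℝ), ((-2) : ℝ)]‖ ^ 2
        - (inner ℝ (x - !₂[(-(3 / 2 : ℝ)), (2 : ℝ), ((-2) : ℝ)])
            !₂[(3 / 7 : ℝ), (-(6 / 7 : ℝ)), (2 / 7 : ℝ)]) ^ 2
          = (9540 * t ^ 2 - 41412 * t + 45521) / 9604 ∧
      inner ℝ (x - !₂[(-(3 / 2 : ℝ)), (2 : ℝ), ((-2) : ℝ)]) v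
        - inner ℝ (x - !₂[(-(3 / 2 : ℝ)), (2 : ℝ), ((-2) : ℝ)])
            !₂[(3 / 7 : ℝ), (-(6 / 7 : ℝ)), (2 / 7 : ℝ)]
          * inner ℝ v !₂[(3 / 7 : ℝ), (-(6 / 7 : ℝ)), (2 / 7 : ℝ)]
          = a * (370 / 49 - 492 / 343 * t) + b * (8 / 7 + 72 / 49 * t) ∧
      inner ℝ (cross !₂[(3 / 7 : ℝ), (-(6 / 7 : ℝ)), (2 / 7 : ℝ)]
          (x - !₂[(-(3 / 2 : ℝ)), (2 : ℝ), ((-2) : ℝ)])) v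
          = a * (271 / 7 - 18 * t) + b * (77 / 2 - 123 / 7 * t) := by
  subst hx hv
  rw [strain_inner_cross_three]
  simp only [strain_norm_sq_three, strain_inner_three]
  simp
  refine ⟨?_, ?_, ?_⟩ <;> ring

/-- The cross directions have `‖a u₁ + b u₂‖² = 637 (a² + b²)`. [folklore] -/
private theorem strain_datum_norm_sq (a b : ℝ) (v : EuclideanSpace ℝ (Fin 3))
    (hv : v = a • !₂[(13 : ℝ), ((-18) : ℝ), ((-12) : ℝ)] + b • !₂[(0 : ℝ), (14 : ℝ), ((-21) : ℝ)]) :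
    ‖v‖ ^ 2 = 637 * (a ^ 2 + b ^ 2) := by
  subst hv
  rw [strain_norm_sq_three]
  simp
  ring

/-- **Link (cross strain).** For the datum `D*`, the directional strain of the inner skeleton field at the point
`x = P₀ + t e₀` in a direction `v = a u₁ + b u₂` of the cross plane `e₀^⊥` (`u₁ = (13, −18, −12)`, `u₂ = (0, 14, −21)`,
orthogonal, `‖u₁‖² = ‖u₂‖² = 637`), i.e. `d/ds ⟪v, W̃(x + s v)⟫|₀ = ⟪v, DW̃(x) v⟫`, is the closed-form quadratic form
`a² S₁₁(t) + 2ab S₁₂(t) + b² S₂₂(t)`. [folklore] -/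
theorem stub_ellipticDatumStrainModel :
    ∀ (S₁₁ S₁₂ S₂₂ : ℝ → ℝ), (∀ t, S₁₁ t = (637 / 2 : ℝ) + (((-2207229696) : ℝ) * t ^ 2 + (14535999744 : ℝ) * t + ((-23557766848) : ℝ)) / (9540 * t ^ 2 - 56532 * t + 84329) ^ 2 + (((-793828224) : ℝ) * t ^ 2 + (6166805232 : ℝ) * t + ((-8480812200) : ℝ)) / (720 * t ^ 2 - 3696 * t + 6664) ^ 2 + (((-4762969344) : ℝ) * t ^ 2 + (35317519104 : ℝ) * t + ((-53927612480) : ℝ)) / (9540 * t ^ 2 - 41412 * t + 45521) ^ 2) →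
      (∀ t, S₁₂ t = (0 : ℝ) + (((-4222225728) : ℝ) * t ^ 2 + (31730540352 : ℝ) * t + ((-56691758928) : ℝ)) / (9540 * t ^ 2 - 56532 * t + 84329) ^ 2 + (((-467791632) : ℝ) * t ^ 2 + ((-233146704) : ℝ) * t + (4928081312 : ℝ)) / (720 * t ^ 2 - 3696 * t + 6664) ^ 2 + ((114787008 : ℝ) * t ^ 2 + (13982348352 : ℝ) * t + ((-30895568592) : ℝ)) / (9540 * t ^ 2 - 41412 * t + 45521) ^ 2) →
      (∀ t, S₂₂ t = (637 / 2 : ℝ) + ((2207229696 : ℝ) * t ^ 2 + (14050114176 : ℝ) * t + ((-61139832320) : ℝ)) / (9540 * t ^ 2 - 56532 * t + 84329) ^ 2 + ((793828224 : ℝ) * t ^ 2 + ((-5088083952) : ℝ) * t + (5712094248 : ℝ)) / (720 * t ^ 2 - 3696 * t + 6664) ^ 2 + ((4762969344 : ℝ) * t ^ 2 + ((-6731405184) : ℝ) * t + ((-8116839808) : ℝ)) / (9540 * t ^ 2 - 41412 * t + 45521) ^ 2) →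
      ∀ (t a b : ℝ) (x v : EuclideanSpace ℝ (Fin 3)), x = !₂[((-2) : ℝ), (-(3 / 2 : ℝ)), ((-2) : ℝ)] + t • !₂[(6 / 7 : ℝ), (3 / 7 : ℝ), (2 / 7 : ℝ)] → v = a • !₂[(13 : ℝ), ((-18) : ℝ), ((-12) : ℝ)] + b • !₂[(0 : ℝ), (14 : ℝ), ((-21) : ℝ)] →
        HasDerivAt (fun s : ℝ => inner ℝ ((1 / 2 : ℝ) • (x + s • v) - (1 : ℝ) • Literature.Analysis.FluidPDE.cross (EuclideanSpace.single (2 : Fin 3) (1 : ℝ)) (x + s • v) + ((1 : ℝ) / (‖(x + s • v) - !₂[(3 / 2 : ℝ), ((-2) : ℝ), ((-2) : ℝ)]‖ ^ 2 - (inner ℝ ((x + s • v) - !₂[(3 / 2 : ℝ), ((-2) : ℝ), ((-2) : ℝ)]) !₂[(-(3 / 7 : ℝ)), (6 / 7 : ℝ), (2 / 7 : ℝ)]) ^ 2)) • Literature.Analysis.FluidPDE.cross !₂[(-(3 / 7 : ℝ)), (6 / 7 : ℝ), (2 / 7 : ℝ)] ((x + s • v) - !₂[(3 / 2 : ℝ),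 ((-2) : ℝ), ((-2) : ℝ)]) + ((1 : ℝ) / (‖(x + s • v) - !₂[(2 : ℝ), (3 / 2 : ℝ), ((-2) : ℝ)]‖ ^ 2 - (inner ℝ ((x + s • v) - !₂[(2 : ℝ), (3 / 2 : ℝ), ((-2) : ℝ)]) !₂[(-(6 / 7 : ℝ)), (-(3 / 7 : ℝ)), (2 / 7 : ℝ)]) ^ 2)) • Literature.Analysis.FluidPDE.cross !₂[(-(6 / 7 : ℝ)), (-(3 / 7 : ℝ)), (2 / 7 : ℝ)] ((x + s • v) - !₂[(2 : ℝ), (3 / 2 : ℝ), ((-2) : ℝ)]) + ((1 : ℝ) / (‖(x + s • v) - !₂[(-(3 / 2 : ℝ)), (2 : ℝ), ((-2) : ℝ)]‖ ^ 2 - (inner ℝ ((x + s • v) - !₂[(-(3 / 2 : ℝ)), (2 : ℝ), ((-2) : ℝ)]) !₂[(3 / 7 : ℝ), (-(6 / 7 : ℝ)), (2 / 7 : ℝ)]) ^ 2)) • Literature.Analysis.FluidPDE.cross !₂[(3 / 7 : ℝ), (-(6 / 7 : ℝ)), (2 / 7 : ℝ)] ((x + s • v) - !₂[(-(3 / 2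 : ℝ)), (2 : ℝ), ((-2) : ℝ)])) v)
          (a ^ 2 * S₁₁ t + 2 * a * b * S₁₂ t + b ^ 2 * S₂₂ t) 0 := by
  intro S₁₁ S₁₂ S₂₂ hS₁₁ hS₁₂ hS₂₂ t a b x v hx hv
  obtain ⟨hD₁, hβ₁, hc₁⟩ := strain_datum_one t a b x v hx hv
  obtain ⟨hD₂, hβ₂, hc₂⟩ := strain_datum_two t a b x v hx hv
  obtain ⟨hD₃, hβ₃, hc₃⟩ := strain_datum_three t a b x v hx hv
  have hvv := strain_datum_norm_sq a b v hv
  have hp₁ : 0 < 9540 * t ^ 2 - 56532 * t + 84329 := by nlinarith [sq_nonneg (9540 * t - 28266)]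
  have hp₂ : 0 < 720 * t ^ 2 - 3696 * t + 6664 := by nlinarith [sq_nonneg (720 * t - 1848)]
  have hp₃ : 0 < 9540 * t ^ 2 - 41412 * t + 45521 := by nlinarith [sq_nonneg (9540 * t - 20706)]
  refine (strain_hasDerivAt_link x v _ _ _ _ _ _ _ 1 ?_ ?_ ?_).congr_deriv ?_
  · rw [hD₁]; exact div_ne_zero hp₁.ne' (by norm_num)
  · rw [hD₂]; exact div_ne_zero hp₂.ne' (by norm_num)
  · rw [hD₃]; exact div_ne_zero hp₃.ne' (by norm_num)
  · rw [hS₁₁, hS₁₂, hS₂₂, hD₁, hD₂, hD₃, hβ₁, hβ₂, hβ₃, hc₁, hc₂, hc₃, hvv]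
    have hq₁ := hp₁.ne'
    have hq₂ := hp₂.ne'
    have hq₃ := hp₃.ne'
    field_simp
    ring

end Summit.NavierStokesRegularity.NavierStokesRegularity.Theorems
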